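import Mathlib

/-!
# [OURS · L1 W4.5(b) · EL♮(3) · IDEATOR 1 · ROUND 18 (v3: + §E♮, §P)] Key-polynomial letters, part 3:
# the CUSTOMER-INDEPENDENT form — (§K) the class incidence lemma «a letter whose tangent cone is supported on the shadow plane
# has its strict transform INSIDE the engine's curve-step centre `𝒞 = 𝓢 ⊔ K`», (§B) the general binary-cubic letter `x² + c(y,z)`
# through the moves `P`, `CAR` with its two equimultiplicity forms and its PROMOTABILITY certificate (Bézout for `c, c'`),
# (§N) the verbatim tower of the characteristic-free letter `M♮ = V(x² + yz(y+z))` through all five moves of the S10 word.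

Companion of `KeyPolynomialLettersR16.lean` (4a3ce5306325ac12), `KeyPolynomialLettersR17.lean` (1562263145bab5d1),
`KeyPolynomialLettersR17Defs.lean` (cf31c12cf1dc7fa5).  Crux item stmt-ResolutionOfSingularities-20148 (`EquisingularLiftNatThree`),
idea card `toric-towers` §ROUND 18.  v2 (2026-08-28, WIDTH TABLE D5 row D5-4 (a), desk R46 (d)) appends §E♮ = the `Polynomial` currency of
`M♮`'s carrier-round lowest form (`keyNat_carrierRound_lowest_monic` / `_ne_zero` / `_eval`); v3 (same day, desk R47 (β) after crit-2's (g3)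
parse l.83403) appends §P = PAIR-HOST INCIDENCE FROM DIVISIBILITY (`cubicLetter_host_pair_Sy_E1x` &c.) + the deformation obstruction identity
`keyNat_deformed_host_phi`; nothing else changed.  OURS; NOT a statement of any manuscript ([Hironaka2017] is a candidate under adjudication, nothing of it
is asserted); AI-written, weaker than expert review; EL♮(3) is NOT proved here or anywhere.  `import Mathlib` only; no `sorry`.

WHAT THIS ROUND ADDS (answer to the desk's gate G5 «customer schedule × typed clause BEFORE any Defs» and to stub-4's Δ2b question):
* §K  Over an arbitrary commutative ring `R`, in `R[X₀,X₁,X₂]` (affine chart `W = 1` of `ℙ³`, `X₀` = the equation of the shadow plane `Π`):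
  if `M = X₀^a · u + N` with `N ∈ (X₀,X₁,X₂)^{a+1}` (tangent cone of the letter supported on `Π`), then in the point chart `S.y`
  (`X₀ ↦ X₀X₁, X₂ ↦ X₂X₁`) the total transform is `X₁^a · G` with `G = X₀^a·u' + X₁·N'`, and `G ∈ (X₀, X₁)` — the ideal of the
  CARRIER `E ∩ St Π`, which in the engine's curve step (✓ `Tower.inv₁_of_invKC_curveStep`, …NatTowerCurveStep) is the chart ideal of the
  centre `𝒞 = 𝓢 ⊔ K` (`𝓢 = (X₁)` the carrier surface `E`, `K = (X₀)` the cone `St Π`).  For `a ≥ 2` moreover `G ≡ X₁·N' (mod (X₀,X₁)²)`: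
  the degree-one form of `G` along the carrier is `N'|_{carrier} · e_{X₁}` — the datum `Φ` of T-M1-EXACT at `r = 2`.  Since the same
  identities hold over the lift ring `O` for the GAUGE lift `M_O` (same support), «`𝓜 ≤ 𝒞`» upstairs is literal and needs no lifted point,
  no rail and no (T-k).  The CAR charts then factor `G` once more through `(X₀)` resp. `(X₁)` (§K, `map_chartCx_carrier_le` / `map_chartCy_carrier_le`).
* §B  The general cubic letter `M_c = x² + c(y,z)`, `c = c₀y³ + c₁y²z + c₂yz² + c₃z³` (coefficients in any commutative ring): chart identities
  for `P` (charts `S.y`, `S.z`, `S.x`) and `CAR` (charts `E1.x`, `E1.y` over `S.y`; `E1.x`, `E1.z` over `S.z`), the forms `X₀²` (point step) and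
  `c(1,z)·e_Y` / `c(y,1)·e_Z` (carrier round), and the PROMOTABILITY CERTIFICATE: in chart `E1.y` the second strict transform is
  `f = y·x² + c(1,z)` with `∂f/∂y = x²`, `∂f/∂z = c'(1,z)`, so `c(1,z) = f − y·∂f/∂y` lies in the Jacobian ideal and ANY Bézout relation
  `α·c(1,z) + β·c'(1,z) = 1` makes the Jacobian ideal the unit ideal (`St²M_c` smooth there); chart `E1.x` has `∂/∂x = 1`.  Hence the R17 design
  rule «`c` has three distinct roots» in certificate form: `M_c` is promotable at stage 2 wherever `disc`-type Bézout constants are units.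
* §N  Instances: `M♮` (`c = y²z + yz²`, `c(1,z) = z + z²`, `c'(1,z) = 1 + 2z`): `(1+2z)² − 4(z+z²) = 1` — a unit in EVERY characteristic
  (2 included), matching kit j316920 (St^k M♮ regular for k ≥ 2 at p ∈ {2,3,5,7,11,13,23,10009}); du Val (`c(1,z) = z + z³`, `c' = 1 + 3z²`):
  `(2+3z²)(1+3z²) − 9z(z+z³) = 2` — promotable exactly where `2` is a unit, matching R17 §C (`duVal_charTwo_singular_line`).  Then the verbatim
  tower of `M♮` through the five moves of the word of record `P · CAR(L̃) · pair(E₁,StΛ)@φ̃_q · pair(E₁,St S)@σ_S · pair(E_φ,St⁴M♮)@σ∗`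
  (charts as in res-L1-w45b-lead-1's `m7/atlas7.sage`; host orders 2,1,1,1,1; lowest forms `x²`, `(z+z²)·y`, `y·z + 1·x`, `y·z + 1·(x+y)`, units).
[cite: GortzWedhorn2020, (13.19) and Prop. 13.96 (2)] [cite: Matsumura1987, Thm. 14.2 and Thm. 30.3 (Jacobian criterion)] — background only;
every statement below is elementary algebra over a commutative ring.
-/

set_option linter.dupNamespace false -- mandated namespace `Summit.<Summit>.<Problem>` of this single-conjunct summit

namespace Summit.ResolutionOfSingularities.ResolutionOfSingularities.Cruxes.EquisingularLiftNatThree.ToricTowers.R18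

open MvPolynomial

section ClassIncidence

/-! ### §K  The class incidence lemma: tangent cone on the shadow ⇒ strict transform inside the curve-step centre -/

variable {R : Type*} [CommRing R]

/-- The point chart `S.y` of the blow-up of `𝔸³_R` at the origin: `X₀ ↦ X₀X₁`, `X₁ ↦ X₁`, `X₂ ↦ X₂X₁`. -/
noncomputable def chartY : MvPolynomial (Fin 3) R →ₐ[R] MvPolynomial (Fin 3) R :=
  MvPolynomial.aeval ![X 0 * X 1, X 1, X 2 * X 1]

@[simp] theorem chartY_X0 : chartY (R := R) (X 0) = X 0 * X 1 := by simp [chartY]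
@[simp] theorem chartY_X1 : chartY (R := R) (X 1) = X 1 := by simp [chartY]
@[simp] theorem chartY_X2 : chartY (R := R) (X 2) = X 2 * X 1 := by simp [chartY]

/-- The ideal of the origin `x₀ = V(X₀, X₁, X₂)` (the section's locus in the affine chart `W = 1`). -/
noncomputable def origin : Ideal (MvPolynomial (Fin 3) R) := Ideal.span {X 0, X 1, X 2}

/-- The ideal of the CARRIER in chart `S.y`: `(X₀, X₁)` = (cone `St Π`) ⊔ (exceptional surface `E`) = the chart ideal of the engine's
curve-step centre `𝒞 = 𝓢 ⊔ K`. -/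
noncomputable def carrier : Ideal (MvPolynomial (Fin 3) R) := Ideal.span {X 0, X 1}

theorem X0_mem_origin : (X 0 : MvPolynomial (Fin 3) R) ∈ origin := Ideal.subset_span (by simp)
theorem X1_mem_origin : (X 1 : MvPolynomial (Fin 3) R) ∈ origin := Ideal.subset_span (by simp)
theorem X2_mem_origin : (X 2 : MvPolynomial (Fin 3) R) ∈ origin := Ideal.subset_span (by simp)
theorem X0_mem_carrier : (X 0 : MvPolynomial (Fin 3) R) ∈ carrier := Ideal.subset_span (by simp)
theorem X1_mem_carrier : (X 1 : MvPolynomial (Fin 3) R) ∈ carrier := Ideal.subset_span (by simp)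

/-- The chart pulls the origin's ideal into the principal ideal of the exceptional divisor `E = V(X₁)`. -/
theorem map_chartY_origin_le : (origin (R := R)).map chartY ≤ Ideal.span {X 1} := by
  rw [origin, Ideal.map_span]
  refine Ideal.span_le.mpr ?_
  rintro _ ⟨p, hp, rfl⟩
  simp only [Set.mem_insert_iff, Set.mem_singleton_iff] at hp
  rcases hp with rfl | rfl | rfl
  · rw [chartY_X0]; exact Ideal.mem_span_singleton.mpr (dvd_mul_left _ _)
  · rw [chartY_X1]; exact Ideal.mem_span_singleton.mpr (dvd_refl _)
  · rw [chartY_X2]; exact Ideal.mem_span_singleton.mpr (dvd_mul_left _ _)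

/-- … and its powers into the corresponding powers: `chartY((X₀,X₁,X₂)ⁿ) ⊆ (X₁ⁿ)`. -/
theorem map_chartY_origin_pow_le (n : ℕ) : ((origin (R := R)) ^ n).map chartY ≤ Ideal.span {X 1 ^ n} := by
  rw [Ideal.map_pow, ← Ideal.span_singleton_pow]
  exact Ideal.pow_right_mono map_chartY_origin_le n

/-- **Class incidence lemma (total transform).**  A letter `M = X₀^a·u + N` with `N ∈ 𝔪^{a+1}` (its tangent cone at the section is
supported on the shadow plane `Π = V(X₀)`) has total transform `X₁^a · (X₀^a·u' + X₁·N')` in chart `S.y`. -/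
theorem chartY_letter {a : ℕ} (u N : MvPolynomial (Fin 3) R) (hN : N ∈ origin ^ (a + 1)) :
    ∃ N' : MvPolynomial (Fin 3) R,
      chartY (X 0 ^ a * u + N) = X 1 ^ a * (X 0 ^ a * chartY u + X 1 * N') := by
  have h1 : chartY N ∈ Ideal.span {X 1 ^ (a + 1)} :=
    map_chartY_origin_pow_le (a + 1) (Ideal.mem_map_of_mem _ hN)
  obtain ⟨N', hN'⟩ := Ideal.mem_span_singleton'.mp h1
  refine ⟨N', ?_⟩
  rw [map_add, map_mul, map_pow, chartY_X0, ← hN']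
  ring

/-- **Class incidence lemma (strict transform inside the centre).**  The strict-transform candidate `G = X₀^a·u' + X₁·N'` (`a ≥ 1`) lies in
the carrier ideal `(X₀, X₁)` — the chart ideal of the curve-step centre `𝒞 = 𝓢 ⊔ K`: the letter HOSTS the carrier round.  Over the lift ring
`O` the same computation for the gauge lift `M_O` gives `𝓜 ≤ 𝒞` literally. -/
theorem strict_mem_carrier {a : ℕ} (ha : 1 ≤ a) (U N' : MvPolynomial (Fin 3) R) :
    X 0 ^ a * U + X 1 * N' ∈ (carrier : Ideal (MvPolynomial (Fin 3) R)) := by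
  refine Ideal.add_mem _ (Ideal.mul_mem_right _ _ ?_) (Ideal.mul_mem_right _ _ X1_mem_carrier)
  exact Ideal.pow_mem_of_mem _ X0_mem_carrier a ha

/-- **Degree-one form along the carrier.**  For `a ≥ 2` the candidate is `≡ X₁·N'` modulo `(X₀,X₁)²`: its degree-one form along the carrier
is `N'|_{carrier} · e_{X₁}` — the datum `Φ` that T-M1-EXACT (`map_blowupAlgebraMap_strictTransformIdeal_eq`, `r = 2`) asks to be non-zero
modulo the centre (for `M_c` below: `Φ = c(1,z)`, a monic-type polynomial in the curve parameter). -/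
theorem strict_sub_linear_mem_carrier_sq {a : ℕ} (ha : 2 ≤ a) (U N' : MvPolynomial (Fin 3) R) :
    X 0 ^ a * U + X 1 * N' - X 1 * N' ∈ (carrier : Ideal (MvPolynomial (Fin 3) R)) ^ 2 := by
  have h : X 0 ^ a * U + X 1 * N' - X 1 * N' = (X 0) ^ 2 * (X 0 ^ (a - 2) * U) := by
    rw [add_sub_cancel_right, ← mul_assoc, ← pow_add, Nat.add_sub_cancel' ha]
  rw [h]
  exact Ideal.mul_mem_right _ _ (Ideal.pow_mem_pow X0_mem_carrier 2)

/-- **Trace on the exceptional plane.**  Modulo `X₁` the candidate is `X₀^a·u'`: the letter's strict transform meets `E = V(X₁)` only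
inside `V(X₀) ∪ V(u')` — along the carrier line (with multiplicity `a`) when `u'` is a unit at the points in question. -/
theorem strict_sub_cone_mem_exceptional {a : ℕ} (U N' : MvPolynomial (Fin 3) R) :
    X 0 ^ a * U + X 1 * N' - X 0 ^ a * U ∈ Ideal.span {(X 1 : MvPolynomial (Fin 3) R)} := by
  rw [add_sub_cancel_left]
  exact Ideal.mem_span_singleton.mpr (dvd_mul_right _ _)

/-- `X₀^a` is not a multiple of `X₁` (evaluate at `(1,0,0)`). -/
theorem X0_pow_not_mem_span_X1 [Nontrivial R] (a : ℕ) :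
    (X 0 : MvPolynomial (Fin 3) R) ^ a ∉ Ideal.span {(X 1 : MvPolynomial (Fin 3) R)} := by
  intro h
  obtain ⟨q, hq⟩ := Ideal.mem_span_singleton'.mp h
  have h2 := congrArg (MvPolynomial.eval ![(1 : R), 0, 0]) hq
  simp only [map_mul, map_pow, MvPolynomial.eval_X, Matrix.cons_val_one, Matrix.cons_val_zero,
    mul_zero, one_pow] at h2
  exact zero_ne_one h2

/-- **Exactness of the exceptional order.**  For `u = 1` (the cubic letters of §B) the candidate `X₀^a + X₁·N'` is NOT divisible by `X₁`:
the total transform vanishes to order EXACTLY `a` along `E`, i.e. the candidate IS the strict transform and `a` is the datum `d` of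
T-M1-EXACT for the point step (`r = 3`, form `X₀^a`). -/
theorem strict_not_mem_exceptional [Nontrivial R] (a : ℕ) (N' : MvPolynomial (Fin 3) R) :
    X 0 ^ a * 1 + X 1 * N' ∉ Ideal.span {(X 1 : MvPolynomial (Fin 3) R)} := by
  intro h
  have h' : X 0 ^ a * 1 + X 1 * N' - X 1 * N' ∈ Ideal.span {(X 1 : MvPolynomial (Fin 3) R)} :=
    Ideal.sub_mem _ h (Ideal.mem_span_singleton.mpr (dvd_mul_right _ _))
  rw [add_sub_cancel_right, mul_one] at h'
  exact X0_pow_not_mem_span_X1 a h'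

/-- The two charts of the CARRIER round (blow-up along `V(X₀, X₁)`): `E1.x` scales `X₁ ↦ X₁X₀`, `E1.y` scales `X₀ ↦ X₀X₁`. -/
noncomputable def chartCx : MvPolynomial (Fin 3) R →ₐ[R] MvPolynomial (Fin 3) R :=
  MvPolynomial.aeval ![X 0, X 1 * X 0, X 2]

noncomputable def chartCy : MvPolynomial (Fin 3) R →ₐ[R] MvPolynomial (Fin 3) R :=
  MvPolynomial.aeval ![X 0 * X 1, X 1, X 2]

@[simp] theorem chartCx_X0 : chartCx (R := R) (X 0) = X 0 := by simp [chartCx]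
@[simp] theorem chartCx_X1 : chartCx (R := R) (X 1) = X 1 * X 0 := by simp [chartCx]
@[simp] theorem chartCx_X2 : chartCx (R := R) (X 2) = X 2 := by simp [chartCx]
@[simp] theorem chartCy_X0 : chartCy (R := R) (X 0) = X 0 * X 1 := by simp [chartCy]
@[simp] theorem chartCy_X1 : chartCy (R := R) (X 1) = X 1 := by simp [chartCy]
@[simp] theorem chartCy_X2 : chartCy (R := R) (X 2) = X 2 := by simp [chartCy]

/-- In chart `E1.x` the carrier ideal becomes the principal ideal `(X₀)` of the new exceptional divisor `E₁` … -/
theorem map_chartCx_carrier_le : (carrier (R := R)).map chartCx ≤ Ideal.span {X 0} := by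
  rw [carrier, Ideal.map_span]
  refine Ideal.span_le.mpr ?_
  rintro _ ⟨p, hp, rfl⟩
  simp only [Set.mem_insert_iff, Set.mem_singleton_iff] at hp
  rcases hp with rfl | rfl
  · rw [chartCx_X0]; exact Ideal.mem_span_singleton.mpr (dvd_refl _)
  · rw [chartCx_X1]; exact Ideal.mem_span_singleton.mpr (dvd_mul_left _ _)

/-- … and in chart `E1.y` the principal ideal `(X₁)`. -/
theorem map_chartCy_carrier_le : (carrier (R := R)).map chartCy ≤ Ideal.span {X 1} := by
  rw [carrier, Ideal.map_span]
  refine Ideal.span_le.mpr ?_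
  rintro _ ⟨p, hp, rfl⟩
  simp only [Set.mem_insert_iff, Set.mem_singleton_iff] at hp
  rcases hp with rfl | rfl
  · rw [chartCy_X0]; exact Ideal.mem_span_singleton.mpr (dvd_mul_left _ _)
  · rw [chartCy_X1]; exact Ideal.mem_span_singleton.mpr (dvd_refl _)

/-- **Carrier round, total transforms.**  A member `G ∈ (X₀, X₁)` of the carrier ideal (e.g. the hosted letter's `St¹M`) factors through the
new exceptional divisor in both charts: `chartCx G = X₀ · G₁`, `chartCy G = X₁ · G₂` (order ≥ 1 along the centre). -/
theorem chartCx_of_mem_carrier {G : MvPolynomial (Fin 3) R} (hG : G ∈ (carrier : Ideal (MvPolynomial (Fin 3) R))) :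
    ∃ G₁, chartCx G = X 0 * G₁ := by
  obtain ⟨G₁, h⟩ := Ideal.mem_span_singleton'.mp (map_chartCx_carrier_le (Ideal.mem_map_of_mem _ hG))
  exact ⟨G₁, by rw [← h, mul_comm]⟩

theorem chartCy_of_mem_carrier {G : MvPolynomial (Fin 3) R} (hG : G ∈ (carrier : Ideal (MvPolynomial (Fin 3) R))) :
    ∃ G₂, chartCy G = X 1 * G₂ := by
  obtain ⟨G₂, h⟩ := Ideal.mem_span_singleton'.mp (map_chartCy_carrier_le (Ideal.mem_map_of_mem _ hG))
  exact ⟨G₂, by rw [← h, mul_comm]⟩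

/-- The explicit second strict transforms of the candidate `G = X₀^a·U + X₁·N'` (`a ≥ 1`): chart `E1.x`: `X₀^{a-1}·U₁ + X₁·N₁`;
chart `E1.y`: `N₂ + X₁^{a-1}X₀^a·U₂` — the shape tested by the promotability certificate of §B. -/
theorem chartCx_strict {a : ℕ} (ha : 1 ≤ a) (U N' : MvPolynomial (Fin 3) R) :
    chartCx (X 0 ^ a * U + X 1 * N') = X 0 * (X 0 ^ (a - 1) * chartCx U + X 1 * chartCx N') := by
  rw [map_add, map_mul, map_mul, map_pow, chartCx_X0, chartCx_X1]
  obtain ⟨b, rfl⟩ := Nat.exists_eq_add_of_le ha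
  rw [Nat.add_sub_cancel_left]
  ring

theorem chartCy_strict {a : ℕ} (ha : 1 ≤ a) (U N' : MvPolynomial (Fin 3) R) :
    chartCy (X 0 ^ a * U + X 1 * N') = X 1 * (chartCy N' + X 1 ^ (a - 1) * X 0 ^ a * chartCy U) := by
  rw [map_add, map_mul, map_mul, map_pow, chartCy_X0, chartCy_X1]
  obtain ⟨b, rfl⟩ := Nat.exists_eq_add_of_le ha
  rw [Nat.add_sub_cancel_left]
  ring

end ClassIncidence

section CubicLetter

/-! ### §B  The general binary-cubic letter `M_c = x² + c(y,z)` through `P` and `CAR`, and its promotability certificate -/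

variable {A : Type*} [CommRing A]

/-- `c(y,z) = c₀y³ + c₁y²z + c₂yz² + c₃z³`. -/
def cubic (c₀ c₁ c₂ c₃ y z : A) : A := c₀ * y ^ 3 + c₁ * y ^ 2 * z + c₂ * y * z ^ 2 + c₃ * z ^ 3

/-- Move `P`: `M_c = x·x + (terms in 𝔪³)` — order two at the section, tangent cone `x²` supported on `Π = V(x)` (the §K hypothesis with `a = 2`,
`u = 1`). -/
theorem cubicLetter_P (c₀ c₁ c₂ c₃ x y z : A) :
    x ^ 2 + cubic c₀ c₁ c₂ c₃ y z = x * x + (y * (y * (c₀ * y + c₁ * z)) + z * (z * (c₂ * y + c₃ * z))) := by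
  unfold cubic; ring

/-- Chart `S.y` (`(x,y,z) ↦ (xy, y, zy)`): total `= y² · St¹M_c`, `St¹M_c = x² + y·c(1,z)`. -/
theorem cubicLetter_total_P_Sy (c₀ c₁ c₂ c₃ x y z : A) :
    (x * y) ^ 2 + cubic c₀ c₁ c₂ c₃ y (z * y) = y ^ 2 * (x ^ 2 + y * cubic c₀ c₁ c₂ c₃ 1 z) := by
  unfold cubic; ring

/-- Move `CAR` in chart `S.y` (centre the carrier `V(x, y)`): `St¹M_c = x·x + c(1,z)·y ∈ (x, y)`, ORDER ONE along the carrier, degree-one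
form `Φ = c(1,z)·e_Y` (non-zero modulo the centre as soon as one coefficient of `c` is). -/
theorem cubicLetter_host_CAR_Sy (c₀ c₁ c₂ c₃ x y z : A) :
    x ^ 2 + y * cubic c₀ c₁ c₂ c₃ 1 z = x * x + cubic c₀ c₁ c₂ c₃ 1 z * y := by ring

/-- Chart `S.z` (`(x,y,z) ↦ (xz, yz, z)`): total `= z² · (x² + z·c(y,1))`; carrier `V(x, z)`, form `c(y,1)·e_Z`. -/
theorem cubicLetter_total_P_Sz (c₀ c₁ c₂ c₃ x y z : A) :
    (x * z) ^ 2 + cubic c₀ c₁ c₂ c₃ (y * z) z = z ^ 2 * (x ^ 2 + z * cubic c₀ c₁ c₂ c₃ y 1) := by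
  unfold cubic; ring

theorem cubicLetter_host_CAR_Sz (c₀ c₁ c₂ c₃ x y z : A) :
    x ^ 2 + z * cubic c₀ c₁ c₂ c₃ y 1 = x * x + cubic c₀ c₁ c₂ c₃ y 1 * z := by ring

/-- Chart `S.x` (`(x,y,z) ↦ (x, yx, zx)`): total `= x² · (1 + x·c(y,z))` — the strict transform is a UNIT on the exceptional plane `{x = 0}`:
`St¹M_c ∩ E ⊂` the carrier line (seen in the other two charts), as §K `strict_sub_cone_mem_exceptional` predicts. -/
theorem cubicLetter_total_P_Sx (c₀ c₁ c₂ c₃ x y z : A) :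
    x ^ 2 + cubic c₀ c₁ c₂ c₃ (y * x) (z * x) = x ^ 2 * (1 + x * cubic c₀ c₁ c₂ c₃ y z) := by
  unfold cubic; ring

/-- Carrier round, chart `S.y/E1.x` (`y ↦ yx`): total `= x · St²M_c`, `St²M_c = x + y·c(1,z)` — SMOOTH (`∂/∂x = 1`). -/
theorem cubicLetter_total_CAR_Sy_E1x (c₀ c₁ c₂ c₃ x y z : A) :
    x ^ 2 + (y * x) * cubic c₀ c₁ c₂ c₃ 1 z = x * (x + y * cubic c₀ c₁ c₂ c₃ 1 z) := by ring

/-- Carrier round, chart `S.y/E1.y` (`x ↦ xy`): total `= y · St²M_c'`, `St²M_c' = y·x² + c(1,z)`. -/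
theorem cubicLetter_total_CAR_Sy_E1y (c₀ c₁ c₂ c₃ x y z : A) :
    (x * y) ^ 2 + y * cubic c₀ c₁ c₂ c₃ 1 z = y * (y * x ^ 2 + cubic c₀ c₁ c₂ c₃ 1 z) := by ring

/-- Carrier round over chart `S.z`: `E1.x` (`z ↦ zx`): `x · (x + z·c(y,1))`; `E1.z` (`x ↦ xz`): `z · (z·x² + c(y,1))`. -/
theorem cubicLetter_total_CAR_Sz_E1x (c₀ c₁ c₂ c₃ x y z : A) :
    x ^ 2 + (z * x) * cubic c₀ c₁ c₂ c₃ y 1 = x * (x + z * cubic c₀ c₁ c₂ c₃ y 1) := by ring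

theorem cubicLetter_total_CAR_Sz_E1z (c₀ c₁ c₂ c₃ x y z : A) :
    (x * z) ^ 2 + z * cubic c₀ c₁ c₂ c₃ y 1 = z * (z * x ^ 2 + cubic c₀ c₁ c₂ c₃ y 1) := by ring

/-- **Promotability certificate (chart `E1.y`).**  For `f = y·x² + γ` with `∂f/∂y = x²` and `∂f/∂z = γ'` (here `γ = c(1,z)`, `γ' = c'(1,z)`):
any Bézout relation `α·γ + β·γ' = 1` exhibits `1` in the Jacobian ideal `(f, ∂f/∂x, ∂f/∂y, ∂f/∂z)`:
`α·f + (−α·y)·(∂f/∂y) + β·(∂f/∂z) = 1`.  So `St²M_c` is smooth over the coefficient ring in this chart whenever `c(1,z)` and `c'(1,z)` are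
coprime — the certificate form of the R17 design rule «three distinct roots». -/
theorem promotable_of_bezout (α β x y γ γ' : A) (h : α * γ + β * γ' = 1) :
    α * (y * x ^ 2 + γ) + (-(α * y)) * x ^ 2 + β * γ' = 1 := by
  rw [← h]; ring

/-- The same certificate in chart `S.z/E1.z` (`f = z·x² + δ`, `δ = c(y,1)`, `∂f/∂z = x²`, `∂f/∂y = δ'`). -/
theorem promotable_of_bezout' (α β x z δ δ' : A) (h : α * δ + β * δ' = 1) :
    α * (z * x ^ 2 + δ) + (-(α * z)) * x ^ 2 + β * δ' = 1 := by
  rw [← h]; ring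

end CubicLetter

section CubicLetterClass

/-! ### §KB  The cubic letter satisfies the class hypothesis of §K with `a = 2`, `u = 1` -/

variable {R : Type*} [CommRing R]

/-- `c(X₁, X₂) ∈ (X₀, X₁, X₂)³`. -/
theorem cubic_mem_origin_cube (c₀ c₁ c₂ c₃ : R) :
    cubic (C c₀) (C c₁) (C c₂) (C c₃) (X 1) (X 2) ∈ (origin : Ideal (MvPolynomial (Fin 3) R)) ^ 3 := by
  have e : (origin : Ideal (MvPolynomial (Fin 3) R)) ^ 3 = origin * origin * origin := by
    rw [pow_succ, pow_two]
  have h3 : ∀ p q r : MvPolynomial (Fin 3) R, p ∈ origin → q ∈ origin → r ∈ origin →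
      p * q * r ∈ (origin : Ideal (MvPolynomial (Fin 3) R)) ^ 3 := by
    intro p q r hp hq hr
    rw [e]
    exact Ideal.mul_mem_mul (Ideal.mul_mem_mul hp hq) hr
  unfold cubic
  refine Ideal.add_mem _ (Ideal.add_mem _ (Ideal.add_mem _ ?_ ?_) ?_) ?_
  · have h : C c₀ * (X 1 : MvPolynomial (Fin 3) R) ^ 3 = C c₀ * (X 1 * X 1 * X 1) := by ring
    rw [h]; exact Ideal.mul_mem_left _ _ (h3 _ _ _ X1_mem_origin X1_mem_origin X1_mem_origin)
  · have h : C c₁ * (X 1 : MvPolynomial (Fin 3) R) ^ 2 * X 2 = C c₁ * (X 1 * X 1 * X 2) := by ring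
    rw [h]; exact Ideal.mul_mem_left _ _ (h3 _ _ _ X1_mem_origin X1_mem_origin X2_mem_origin)
  · have h : C c₂ * (X 1 : MvPolynomial (Fin 3) R) * X 2 ^ 2 = C c₂ * (X 1 * X 2 * X 2) := by ring
    rw [h]; exact Ideal.mul_mem_left _ _ (h3 _ _ _ X1_mem_origin X2_mem_origin X2_mem_origin)
  · have h : C c₃ * (X 2 : MvPolynomial (Fin 3) R) ^ 3 = C c₃ * (X 2 * X 2 * X 2) := by ring
    rw [h]; exact Ideal.mul_mem_left _ _ (h3 _ _ _ X2_mem_origin X2_mem_origin X2_mem_origin)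

/-- `M_c = X₀² · 1 + N` with `N = c(X₁,X₂) ∈ 𝔪³`: the §K hypothesis with `a = 2`, `u = 1`. -/
theorem cubicLetter_classShape (c₀ c₁ c₂ c₃ : R) :
    (X 0 ^ 2 + cubic (C c₀) (C c₁) (C c₂) (C c₃) (X 1) (X 2) : MvPolynomial (Fin 3) R)
      = X 0 ^ 2 * 1 + cubic (C c₀) (C c₁) (C c₂) (C c₃) (X 1) (X 2) := by ring

/-- Hence §K applies to every cubic letter: total transform `X₁² · (X₀²·1 + X₁·N')` in chart `S.y`, strict candidate in the carrier ideal
(`strict_mem_carrier`), degree-one form `N'|_{carrier}·e_{X₁}` (`strict_sub_linear_mem_carrier_sq` with `a = 2`); §B names `N' = c(1, X₂)`-type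
explicitly. -/
theorem cubicLetter_total_exists (c₀ c₁ c₂ c₃ : R) :
    ∃ N' : MvPolynomial (Fin 3) R,
      chartY (X 0 ^ 2 + cubic (C c₀) (C c₁) (C c₂) (C c₃) (X 1) (X 2))
        = X 1 ^ 2 * (X 0 ^ 2 * chartY 1 + X 1 * N') := by
  rw [cubicLetter_classShape]
  exact chartY_letter 1 _ (cubic_mem_origin_cube c₀ c₁ c₂ c₃)

end CubicLetterClass

section Instances

/-! ### §N  Instances: `M♮ = V(x² + yz(y+z))` (every characteristic) and the du Val letter (away from 2); the verbatim tower of `M♮` -/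

variable {A : Type*} [CommRing A]

/-- `M♮`'s cubic is `cubic 0 1 1 0`: `c(y,z) = y²z + yz² = yz(y+z)`. -/
theorem keyNat_cubic (y z : A) : cubic 0 1 1 0 y z = y * z * (y + z) := by unfold cubic; ring

/-- `c(1,z) = z + z²` and `c(y,1) = y² + y` for `M♮`. -/
theorem keyNat_cubic_one_left (z : A) : cubic 0 1 1 0 1 z = z + z ^ 2 := by unfold cubic; ring
theorem keyNat_cubic_one_right (y : A) : cubic 0 1 1 0 y 1 = y ^ 2 + y := by unfold cubic; ring

/-- **`M♮` is promotable in EVERY characteristic**: Bézout `(−4)·(z+z²) + (1+2z)·(1+2z) = 1` for `γ = z + z²`, `γ' = 1 + 2z` (chart `E1.y`),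
and identically for `δ = y² + y`, `δ' = 2y + 1` (chart `E1.z`); chart `E1.x` is smooth by `∂/∂x = 1`.  The three A₁ points `z(1+z) = 0`,
`y = 0 (z = ∞)` of `St¹M♮` on the carrier are resolved by the carrier round itself — over `ℤ`, hence over every field and over `O`. -/
theorem keyNat_bezout (z : A) : (-4) * (z + z ^ 2) + (1 + 2 * z) * (1 + 2 * z) = 1 := by ring

theorem keyNat_promotable_E1y (x y z : A) :
    (-4) * (y * x ^ 2 + (z + z ^ 2)) + (-((-4) * y)) * x ^ 2 + (1 + 2 * z) * (1 + 2 * z) = 1 :=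
  promotable_of_bezout (-4) (1 + 2 * z) x y (z + z ^ 2) (1 + 2 * z) (keyNat_bezout z)

theorem keyNat_promotable_E1z (x y z : A) :
    (-4) * (z * x ^ 2 + (y ^ 2 + y)) + (-((-4) * z)) * x ^ 2 + (1 + 2 * y) * (2 * y + 1) = 1 :=
  promotable_of_bezout' (-4) (1 + 2 * y) x z (y ^ 2 + y) (2 * y + 1) (by ring)

/-- **du Val contrast**: for `c(1,z) = z + z³`, `c' = 1 + 3z²` the best Bézout constant is `2`: `(2+3z²)(1+3z²) − 9z(z+z³) = 2` — the du Val
letter is promotable exactly where `2` is a unit (R17 §C shows the degeneration at `2 = 0`). -/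
theorem duVal_bezout_two (z : A) : (2 + 3 * z ^ 2) * (1 + 3 * z ^ 2) - 9 * z * (z + z ^ 3) = 2 := by ring

/-! #### The verbatim tower of `M♮` through the five moves (host orders 2, 1, 1, 1, 1; kit j316920 at eight primes incl. 2) -/

/-- Move `P`: `M♮ = x·x + (y(yz) + z(yz))`, form `x²`. -/
theorem keyNat_host_P (x y z : A) : x ^ 2 + y ^ 2 * z + y * z ^ 2 = x * x + (y * (y * z) + z * (y * z)) := by ring

/-- Chart `S.y`: total `= y² · St¹M♮`, `St¹M♮ = x² + yz + yz²`. -/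
theorem keyNat_total_P_Sy (x y z : A) : (x * y) ^ 2 + y ^ 2 * (z * y) + y * (z * y) ^ 2 = y ^ 2 * (x ^ 2 + y * z + y * z ^ 2) := by
  ring

/-- Move `CAR` (carrier `V(x,y)` in chart `S.y`): `St¹M♮ = x·x + (z+z²)·y`, order one, lowest coefficient `z(1+z)` — TWO SIMPLE ROOTS IN EVERY
CHARACTERISTIC (the third A₁ point is `y = 0` of chart `S.z`). -/
theorem keyNat_host_CAR_Sy (x y z : A) : x ^ 2 + y * z + y * z ^ 2 = x * x + (z + z ^ 2) * y := by ring

theorem keyNat_car_lowest_factor (z : A) : z + z ^ 2 = z * (1 + z) := by ring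

/-- Chart `S.z`: total `= z² · (x² + zy² + zy)`, carrier `V(x,z)`, lowest coefficient `y² + y = y(y+1)`. -/
theorem keyNat_total_P_Sz (x y z : A) : (x * z) ^ 2 + (y * z) ^ 2 * z + (y * z) * z ^ 2 = z ^ 2 * (x ^ 2 + z * y ^ 2 + z * y) := by
  ring

theorem keyNat_host_CAR_Sz (x y z : A) : x ^ 2 + z * y ^ 2 + z * y = x * x + (y ^ 2 + y) * z := by ring

/-- Carrier round, chart `S.y/E1.x` (`y ↦ yx`): total `= x · St²M♮`, `St²M♮ = x + yz + yz²`. -/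
theorem keyNat_total_CAR_Sy_E1x (x y z : A) : x ^ 2 + (y * x) * z + (y * x) * z ^ 2 = x * (x + y * z + y * z ^ 2) := by ring

/-- Carrier round, chart `S.y/E1.y` (`x ↦ xy`): total `= y · (y·x² + z + z²)` — the chart of the promotability certificate `keyNat_promotable_E1y`. -/
theorem keyNat_total_CAR_Sy_E1y (x y z : A) : (x * y) ^ 2 + y * z + y * z ^ 2 = y * (y * x ^ 2 + (z + z ^ 2)) := by ring

/-- Move `φ̃_q` (centre `E₁ ∩ St Λ = V(x, z)` in chart `S.y/E1.x`): `St²M♮ = x + (y + yz)·z ∈ (x, z)`, order one, lowest coefficient `y(1+z)`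
(`= w` on the centre, as measured). -/
theorem keyNat_host_phi_Sy_E1x (x y z : A) : x + y * z + y * z ^ 2 = x + (y + y * z) * z := by ring

/-- Move `σ_S` seen from stage 2 (centre `V(x, y)` in chart `S.y/E1.x`): `St²M♮ = x + (z + z²)·y ∈ (x, y)`. -/
theorem keyNat_host_sigmaS_Sy_E1x (x y z : A) : x + y * z + y * z ^ 2 = x + (z + z ^ 2) * y := by ring

/-- Round at `φ̃_q`, chart `Ephi.z` (`x ↦ xz`): total `= z · St³M♮`, `St³M♮ = x + y + yz`. -/
theorem keyNat_total_PHI_Ephiz (x y z : A) : x * z + y * z + y * z ^ 2 = z * (x + y + y * z) := by ring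

/-- Round at `φ̃_q`, chart `Ephi.x` (`z ↦ zx`): total `= x · St³M♮'`, `St³M♮' = 1 + yz + xyz²`. -/
theorem keyNat_total_PHI_Ephix (x y z : A) : x + y * (z * x) + y * (z * x) ^ 2 = x * (1 + y * z + x * y * z ^ 2) := by ring

/-- Move `σ_S` (centre `V(y, x+y)` in chart `Ephi.z`): `St³M♮ = (x+y) + z·y`, order one. -/
theorem keyNat_host_sigmaS_Ephiz (x y z : A) : x + y + y * z = (x + y) + z * y := by ring

/-- `σ∗ = E_φ ∩ St M♮ = V(x, 1+yz)` in chart `Ephi.x`: `St³M♮' = (1+yz) + x·(yz²)`. -/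
theorem keyNat_host_sigmaStar_Ephix (x y z : A) : 1 + y * z + x * y * z ^ 2 = (1 + y * z) + x * (y * z ^ 2) := by ring

/-- Round at `σ_S`, chart `Ephi.z/EsS.x` (`y ↦ yx`): total `= x · St⁴M♮`, `St⁴M♮ = 1 + y + yz`. -/
theorem keyNat_total_SIGS_Ephiz_EsSx (x y z : A) : x + y * x + (y * x) * z = x * (1 + y + y * z) := by ring

/-- Round at `σ_S`, chart `Ephi.z/EsS.y` (`x ↦ xy`): total `= y · St⁴M♮'`, `St⁴M♮' = x + 1 + z`. -/
theorem keyNat_total_SIGS_Ephiz_EsSy (x y z : A) : x * y + y + y * z = y * (x + 1 + z) := by ring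

/-- Move `σ∗` (centre `E_φ ∩ St⁴M♮ = V(z, 1+y)` in chart `Ephi.z/EsS.x`): `St⁴M♮ = (1+y) + z·y` — unit coefficients, no jump. -/
theorem keyNat_host_sigmaStar_EsSx (y z : A) : 1 + y + y * z = (1 + y) + z * y := by ring

/-- Move `σ∗` in chart `Ephi.z/EsS.y`: `St⁴M♮' = (x+1) + z·1 ∈ (z, x+1)`. -/
theorem keyNat_host_sigmaStar_EsSy (x z : A) : x + 1 + z = (x + 1) + z * 1 := by ring

/-! #### §E♮  Equimultiplicity currency of the carrier round for `M♮` (the `Polynomial` twins of R17 §E `carrierRound_lowest_monic` /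
`carrierRound_lowest_ne_zero`, which type the du Val lowest form `X³ + X`; shape first written in res-L1-w45b-crit-2 g7's custody scratch
`r46/R17nat_twins.lean` 647f471385ce5c2a as `carrierRoundNat_lowest_monic` — re-typed here so WIDTH TABLE D5 can cite `M♮`'s certificates BY NAME;
desk R46 (d): the clause's equimultiplicity hypothesis is T-M1-EXACT's `hΦb` «lowest form reduced mod `(ϖ, Ī)` is non-zero», discharged per customer by
a monic lowest form). Chart `S.y`: lowest coefficient `z + z²`; chart `S.z`: `y² + y` — the same polynomial `X² + X`. -/

/-- The lowest form `X² + X` of `St¹M♮` along the carrier (charts `S.y` and `S.z` alike) is MONIC over every commutative ring. -/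
theorem keyNat_carrierRound_lowest_monic (k : Type*) [CommRing k] :
    (Polynomial.X ^ 2 + Polynomial.X : Polynomial k).Monic :=
  Polynomial.monic_X_pow_add (p := (Polynomial.X : Polynomial k)) (n := 2)
    ((Polynomial.degree_X_le (R := k)).trans_lt (by exact_mod_cast (by norm_num : (1 : ℕ) < 2)))

/-- Hence non-zero over every non-trivial commutative ring (every field `k`, every DVR `O`, every residue ring): the `hΦb`-currency of T-M1-EXACT. -/
theorem keyNat_carrierRound_lowest_ne_zero (k : Type*) [CommRing k] [Nontrivial k] :
    (Polynomial.X ^ 2 + Polynomial.X : Polynomial k) ≠ 0 :=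
  (keyNat_carrierRound_lowest_monic k).ne_zero

/-- The ring-level bridge: evaluating `X² + X` at `z` gives the chart coefficient `z + z²` of `keyNat_host_CAR_Sy` (and at `y` that of `keyNat_host_CAR_Sz`). -/
theorem keyNat_carrierRound_lowest_eval (z : A) :
    Polynomial.eval z (Polynomial.X ^ 2 + Polynomial.X : Polynomial A) = z + z ^ 2 := by
  simp [add_comm]

/-! ### §P  PAIR-HOST INCIDENCE FROM DIVISIBILITY — the discharge shape of D5-0b v1's (i-B) GAUGE-COMPATIBILITY datum (desk R47 (β); necessity:
res-L1-w45b-crit-2 g7's witness `M_O = M♮ + t·ỹ³`, parse l.83403).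

Setting of §B: letter `M_c = x² + c(y,z)`, `Π = V(x)`, a second hyperplane letter `Λ = V(αx + βy + γz)` through the section; on the exceptional plane
`E ≅ ℙ²_{(x:y:z)}` the carrier is the line `x = 0` and `St Λ ∩ E = V(βy + γz)|_E` meets it at the point `(β y + γ z = 0)`.  The jump locus of the
carrier round is `c = 0` on the carrier.  AFTER the carrier round (chart `S.y/E1.x`), the pair centre of the next move is `φ̃ = E₁ ∩ St Λ = V(x, β + γz)`
and `St²M_c = x + y·c(1,z)` (`cubicLetter_total_CAR_Sy_E1x`).  CLAIM (an identity over EVERY commutative ring, hence upstairs over `O` for any lift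
with the same shape): if the binary cubic FACTORS THROUGH the letter's trace, `c(y,z) = (βy + γz)·b(y,z)`, then `St²M_c ∈ (x, β + γz)` — the host
incidence `St²𝓜 ≤ 𝓔₁ ⊔ St𝓛_Λ` is LITERAL.  Conversely the deformation `c_t = c + t·y³` of `M♮`'s cubic (still a key form, same special fibre at
`t = 0`) has `St²M_t = (x + (y+yz)·z) + t·y`, whose obstruction term `t·y` is not in `(x, z)` unless `t = 0`: downstairs incidence + flatness do NOT
give upstairs incidence; the BIRTH SUPPLIER must choose the lift's cubic part divisible by the lifted trace `β̃y + γ̃z` (S10: `w ∣ w² + w` lifts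
verbatim).  `M♮ = x² + yz(y+z)` is compatible with all three traces `y`, `z`, `y + z` at once. -/

/-- `b(y,z) = b₀y² + b₁yz + b₂z²`. -/
def quad (b₀ b₁ b₂ y z : A) : A := b₀ * y ^ 2 + b₁ * y * z + b₂ * z ^ 2

/-- The cubic with coefficients `(βb₀, βb₁+γb₀, βb₂+γb₁, γb₂)` is `(βy + γz)·b(y,z)` — the (i-B) datum «`ℓ_Λ|_E ∣ c`» in coefficient form. -/
theorem cubic_of_linear_mul_quad (β γ b₀ b₁ b₂ y z : A) :
    cubic (β * b₀) (β * b₁ + γ * b₀) (β * b₂ + γ * b₁) (γ * b₂) y z = (β * y + γ * z) * quad b₀ b₁ b₂ y z := by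
  unfold cubic quad; ring

/-- **Pair-host incidence, chart `S.y/E1.x`:** `St²M_c = x·1 + (β + γz)·(y·b(1,z)) ∈ (x, β + γz) = 𝓔₁ ⊔ St𝓛_Λ` whenever `c = (βy+γz)·b`. -/
theorem cubicLetter_host_pair_Sy_E1x (β γ b₀ b₁ b₂ x y z : A) :
    x + y * cubic (β * b₀) (β * b₁ + γ * b₀) (β * b₂ + γ * b₁) (γ * b₂) 1 z = x * 1 + (β + γ * z) * (y * quad b₀ b₁ b₂ 1 z) := by
  unfold cubic quad; ring

/-- The `S.z/E1.x` twin: `St²M_c = x + z·c(y,1) = x·1 + (βy + γ)·(z·b(y,1)) ∈ (x, βy + γ)`. -/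
theorem cubicLetter_host_pair_Sz_E1x (β γ b₀ b₁ b₂ x y z : A) :
    x + z * cubic (β * b₀) (β * b₁ + γ * b₀) (β * b₂ + γ * b₁) (γ * b₂) y 1 = x * 1 + (β * y + γ) * (z * quad b₀ b₁ b₂ y 1) := by
  unfold cubic quad; ring

/-- `St Λ`'s own chart equation lies in the pair ideal trivially: `αx + (β + γz) = x·α + (β + γz)·1`. -/
theorem hyperplaneLetter_pair_Sy_E1x (α β γ x z : A) : α * x + (β + γ * z) = x * α + (β + γ * z) * 1 := by ring

/-- `M♮`'s cubic `yz(y+z)` factors through ALL THREE traces: `z·(y² + yz)`, `y·(yz + z²)`, `(y+z)·(yz)`. -/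
theorem keyNat_cubic_eq_z_mul (y z : A) : cubic 0 1 1 0 y z = (0 * y + 1 * z) * quad 1 1 0 y z := by unfold cubic quad; ring
theorem keyNat_cubic_eq_y_mul (y z : A) : cubic 0 1 1 0 y z = (1 * y + 0 * z) * quad 0 1 1 y z := by unfold cubic quad; ring
theorem keyNat_cubic_eq_ypz_mul (y z : A) : cubic 0 1 1 0 y z = (1 * y + 1 * z) * quad 0 1 0 y z := by unfold cubic quad; ring

/-- Instance check: with the trace `z` (`β = 0, γ = 1, b = quad 1 1 0`) the general identity IS `keyNat_host_phi_Sy_E1x` (`x + (y + yz)·z`). -/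
theorem keyNat_host_phi_of_pair (x y z : A) : x + y * cubic 0 1 1 0 1 z = x * 1 + (0 + 1 * z) * (y * quad 1 1 0 1 z) := by
  unfold cubic quad; ring

/-- **crit-2's necessity witness, typed as the obstruction identity:** for the deformed cubic `c_t = t·y³ + y²z + yz²` (a key form with the same
special fibre), `St²M_t = x + y·c_t(1,z) = (x·1 + z·(y + yz)) + t·y` — the term `t·y` is the obstruction to `St²M_t ∈ (x, z)`; it vanishes iff
`t = 0` on the relevant chart ring (e.g. `t·y ∉ (x, z)` in `O[x,y,z]` for `t ≠ 0` in a domain `O`). -/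
theorem keyNat_deformed_host_phi (t x y z : A) : x + y * cubic t 1 1 0 1 z = (x * 1 + z * (y + y * z)) + t * y := by
  unfold cubic; ring

end Instances

end Summit.ResolutionOfSingularities.ResolutionOfSingularities.Cruxes.EquisingularLiftNatThree.ToricTowers.R18
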